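import Mathlib
import Literature.MeasureTheory.Integral.BernsteinCompletelyMonotone
import HarnessLib

/-!
# Bernstein's theorem, derivative form: smooth functions with `(-1)ⁿ f⁽ⁿ⁾ ≥ 0` on `(0,∞)`

Companion of `BernsteinCompletelyMonotone.lean` (difference form).  A function smooth on `(0,∞)` with
alternating derivative signs has alternating iterated differences
(`alternating_of_iteratedDeriv_alternating`: induction on the order, the `(k+1)`-st difference of `g` being
the `k`-th difference of `τ ↦ g τ - g (τ + h) = ∫_0^h (-g')(τ + σ) dσ`, and `-g'` is again in the class);
hence, if bounded above, it is the Laplace transform of a finite positive measure on `[0,∞)`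
(`exists_measure_laplace_eq_of_iteratedDeriv_alternating`).  [Widder 1941, Ch. IV §2 and Thm. 12a;
Berg–Christensen–Ressel 1984, Ch. 4, Thm. 6.13.]

## References
* D. V. Widder, *The Laplace Transform*, Princeton Univ. Press (1941), Ch. IV §§2–4, Thm. 12a. [Widder1941]
* C. Berg, J. P. R. Christensen, P. Ressel, *Harmonic Analysis on Semigroups*, GTM 100 (1984), Ch. 4,
  Thm. 6.13. [BergChristensenRessel1984]
-/

noncomputable section

open MeasureTheory Set Filter Topology
open scoped ContDiff

namespace Literature.MeasureTheory.Integral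

/-! ## The derivative form -/

namespace BernsteinCompletelyMonotone

/-- One difference step: for `g` smooth on `(0,∞)`, `g τ - g (τ + h) = ∫_0^h (-g') (τ + σ) dσ` (`τ, h > 0`). [folklore] -/
private theorem sub_shift_eq_integral {g : ℝ → ℝ} (hg : ContDiffOn ℝ ∞ g (Ioi 0)) {τ h : ℝ} (hτ : 0 < τ) (hh : 0 < h) :
    g τ - g (τ + h) = ∫ σ in (0 : ℝ)..h, -deriv g (τ + σ) := by
  have hderiv : ∀ x ∈ uIcc τ (τ + h), HasDerivAt g (deriv g x) x := by
    intro x hx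
    rw [uIcc_of_le (by linarith)] at hx
    have hx0 : 0 < x := hτ.trans_le hx.1
    exact ((hg.contDiffAt (Ioi_mem_nhds hx0)).differentiableAt (by simp)).hasDerivAt
  have hcont : ContinuousOn (deriv g) (Ioi 0) :=
    ((contDiffOn_infty_iff_deriv_of_isOpen isOpen_Ioi).1 hg).2.continuousOn
  have hint : IntervalIntegrable (deriv g) volume τ (τ + h) := by
    refine (hcont.mono ?_).intervalIntegrable
    rw [uIcc_of_le (by linarith)]
    exact fun x hx => hτ.trans_le hx.1
  have hftc := intervalIntegral.integral_eq_sub_of_hasDerivAt hderiv hint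
  rw [intervalIntegral.integral_neg, intervalIntegral.integral_comp_add_left (fun x => deriv g x) τ,
    add_zero, hftc]
  ring

/-- `-g'` is again smooth on `(0,∞)` with alternating derivatives (the class of completely monotone functions is stable
under `g ↦ -g'`). [cite: Widder1941, Ch. IV §2] -/
theorem neg_deriv_mem {g : ℝ → ℝ} (hg : ContDiffOn ℝ ∞ g (Ioi 0))
    (hsign : ∀ (n : ℕ) (t : ℝ), 0 < t → 0 ≤ (-1 : ℝ) ^ n * iteratedDeriv n g t) :
    ContDiffOn ℝ ∞ (fun x => -deriv g x) (Ioi 0) ∧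
      ∀ (n : ℕ) (t : ℝ), 0 < t → 0 ≤ (-1 : ℝ) ^ n * iteratedDeriv n (fun x => -deriv g x) t := by
  refine ⟨((contDiffOn_infty_iff_deriv_of_isOpen isOpen_Ioi).1 hg).2.neg, fun n t ht => ?_⟩
  have h1 : iteratedDeriv n (fun x => -deriv g x) t = -iteratedDeriv (n + 1) g t := by
    rw [iteratedDeriv_succ', ← iteratedDeriv_neg]
    rfl
  rw [h1]
  have := hsign (n + 1) t ht
  rw [pow_succ] at this
  linarith

/-- **Smooth completely monotone functions have alternating differences**: if `g` is smooth on `(0,∞)` with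
`(-1)^n g^{(n)} ≥ 0` there, then `∑_{i ≤ k} (-1)^i C(k,i) g(t + i h) ≥ 0` (`h, t > 0`).  Induction on `k`:
the `(k+1)`-st alternating difference of `g` is the `k`-th of `τ ↦ g τ - g (τ + h) = ∫_0^h (-g')(τ + σ) dσ`.
[cite: Widder1941, Ch. IV §2] -/
theorem alternating_of_iteratedDeriv_alternating :
    ∀ (k : ℕ) (g : ℝ → ℝ), ContDiffOn ℝ ∞ g (Ioi 0) →
      (∀ (n : ℕ) (t : ℝ), 0 < t → 0 ≤ (-1 : ℝ) ^ n * iteratedDeriv n g t) →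
      ∀ (h t : ℝ), 0 < h → 0 < t →
        0 ≤ ∑ i ∈ Finset.range (k + 1), (-1 : ℝ) ^ i * (k.choose i : ℝ) * g (t + i * h) := by
  intro k
  induction k with
  | zero =>
    intro g _ hsign h t _ ht
    have := hsign 0 t ht
    simpa using this
  | succ k ih =>
    intro g hg hsign h t hh ht
    -- Pascal: the `(k+1)`-st difference of `g` = the `k`-th difference of `D g := g - g(· + h)`
    have hpascal : ∑ i ∈ Finset.range (k + 1 + 1), (-1 : ℝ) ^ i * ((k + 1).choose i : ℝ) * g (t + i * h) =
        ∑ i ∈ Finset.range (k + 1), (-1 : ℝ) ^ i * (k.choose i : ℝ) * (g (t + i * h) - g (t + i * h + h)) := by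
      have hsplit : ∀ i ∈ Finset.range (k + 1 + 1), (-1 : ℝ) ^ i * ((k + 1).choose i : ℝ) * g (t + i * h) =
          (-1 : ℝ) ^ i * (k.choose i : ℝ) * g (t + i * h) +
            (if i = 0 then 0 else (-1 : ℝ) ^ i * (k.choose (i - 1) : ℝ) * g (t + i * h)) := by
        intro i _
        rcases Nat.eq_zero_or_pos i with rfl | hi
        · simp
        · obtain ⟨j, rfl⟩ := Nat.exists_eq_succ_of_ne_zero hi.ne'
          rw [Nat.choose_succ_succ', if_neg (Nat.succ_ne_zero j), Nat.succ_sub_one]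
          push_cast
          ring
      rw [Finset.sum_congr rfl hsplit, Finset.sum_add_distrib]
      -- first part: the top term vanishes (`C(k, k+1) = 0`)
      rw [Finset.sum_range_succ (fun i => (-1 : ℝ) ^ i * (k.choose i : ℝ) * g (t + i * h)) (k + 1),
        Nat.choose_succ_self, Nat.cast_zero, mul_zero, zero_mul, add_zero]
      -- second part: reindex `i = j + 1`
      rw [Finset.sum_range_succ' (fun i => if i = 0 then (0 : ℝ) else
        (-1 : ℝ) ^ i * (k.choose (i - 1) : ℝ) * g (t + i * h)) (k + 1)]
      simp only [if_true, add_zero, Nat.succ_ne_zero, if_false, Nat.add_sub_cancel]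
      rw [← Finset.sum_add_distrib]
      refine Finset.sum_congr rfl fun i _ => ?_
      push_cast
      ring_nf
    rw [hpascal]
    -- each difference is an integral of `-g'`
    have hD : ∀ i ∈ Finset.range (k + 1), (-1 : ℝ) ^ i * (k.choose i : ℝ) * (g (t + i * h) - g (t + i * h + h)) =
        ∫ σ in (0 : ℝ)..h, (-1 : ℝ) ^ i * (k.choose i : ℝ) * -deriv g (t + σ + i * h) := by
      intro i _
      have hτ : 0 < t + i * h := by positivity
      rw [sub_shift_eq_integral hg hτ hh, ← intervalIntegral.integral_const_mul]
      refine intervalIntegral.integral_congr fun σ _ => ?_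
      rw [show t + (i : ℝ) * h + σ = t + σ + (i : ℝ) * h by ring]
    rw [Finset.sum_congr rfl hD, ← intervalIntegral.integral_finsetSum]
    · refine intervalIntegral.integral_nonneg hh.le fun σ hσ => ?_
      obtain ⟨hg', hsign'⟩ := neg_deriv_mem hg hsign
      exact ih (fun x => -deriv g x) hg' hsign' h (t + σ) hh (by linarith [hσ.1])
    · intro i _
      have hcont : ContinuousOn (fun σ : ℝ => (-1 : ℝ) ^ i * (k.choose i : ℝ) * -deriv g (t + σ + i * h))
          (uIcc 0 h) := by
        have hdc : ContinuousOn (deriv g) (Ioi 0) :=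
          ((contDiffOn_infty_iff_deriv_of_isOpen isOpen_Ioi).1 hg).2.continuousOn
        refine ContinuousOn.mul continuousOn_const (ContinuousOn.neg ?_)
        refine hdc.comp (by fun_prop) fun σ hσ => ?_
        rw [uIcc_of_le hh.le] at hσ
        show 0 < t + σ + i * h
        have : (0 : ℝ) ≤ i * h := by positivity
        linarith [hσ.1]
      exact hcont.intervalIntegrable

end BernsteinCompletelyMonotone

/-- **Bernstein's theorem (derivative form).**  A function smooth on `(0,∞)`, bounded above there, with
`(-1)^n f^{(n)} ≥ 0` for all `n`, is the Laplace transform of a finite positive measure on `[0,∞)`: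
`f t = ∫ e^{-t s} dμ(s)` (`t > 0`) and `f(0+) = μ(ℝ)`.
[cite: Widder1941, Ch. IV Thm. 12a] [cite: BergChristensenRessel1984, Ch. 4 Thm. 6.13] -/
theorem exists_measure_laplace_eq_of_iteratedDeriv_alternating (f : ℝ → ℝ) (hf : ContDiffOn ℝ ∞ f (Ioi 0))
    (hsign : ∀ (n : ℕ) (t : ℝ), 0 < t → 0 ≤ (-1 : ℝ) ^ n * iteratedDeriv n f t)
    (hbdd : ∃ C : ℝ, ∀ t, 0 < t → f t ≤ C) :
    ∃ μ : Measure ℝ, IsFiniteMeasure μ ∧ μ (Iio 0) = 0 ∧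
      (∀ t : ℝ, 0 < t → f t = ∫ s, Real.exp (-(t * s)) ∂μ) ∧
      Tendsto f (𝓝[>] 0) (𝓝 (μ.real univ)) :=
  exists_measure_laplace_eq_of_alternating f hf.continuousOn
    (fun k h t hh ht => BernsteinCompletelyMonotone.alternating_of_iteratedDeriv_alternating k f hf hsign h t hh ht) hbdd

end Literature.MeasureTheory.Integral

end
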